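import Summits.AtomisticToContinuum.Crystallization.Theorems.FrustratedLawDichotomyStrainedPatchHostStep

/-!
# Strained patch — BOND CALCULUS: the LJ bond force is C² off the origin with `D bondForce = pairHess` and `D pairHess = bondD3` in CLOSED FORM,
# so the per-bond leaf (C2L) `BondHessLip bondD3 L s₀ r m` reduces to the LIPSCHITZ TABLE of `bondD3`, and further to the SCALAR γ-TABLE `bondGamma ≤ L`, on the bond shells
# (decomp-a2c lens-5, generation 73 part 3, sequel of `…StrainedPatchTaylorCharge` / `…StrainedPatchHostStep`; crux `AperiodicFrustratedLawGap`, stmt-AtomisticToContinuum-27623)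

`bondForce x = φ(‖x‖)·x`, `φ(r) = V′(r)/r = −r⁻¹⁴ + r⁻⁸`; `pairHess x = ψ(‖x‖)·⟨x,·⟩x + φ(‖x‖)·1`, `ψ = φ′/r = 14r⁻¹⁶ − 8r⁻¹⁰` (`bondPsi`);
`bondD3 x u v = χ(‖x‖)⟨x,u⟩⟨x,v⟩·x + ψ(‖x‖)(⟨u,v⟩·x + ⟨x,v⟩·u + ⟨x,u⟩·v)`, `χ = ψ′/r = −224r⁻¹⁸ + 80r⁻¹²` (`bondChi`) — the census B-table.
Main results: `hasFDerivAt_bondForce`, `hasFDerivAt_pairHess` (`x ≠ 0`), `bondHessLip_of_table` / `bondHessLip_of_gammaTable` ((C2L) from the Lipschitz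
table, resp. from the SCALAR γ-table `bondGamma ≤ L` on the `m`-bands of the shells), `pricedCharge_quadPrice_of_gammaTable` (the M-leaf) and the record
`coreOff_of_gammaTable_hostTables` = (CORE-FAR) from: the γ-table, host separation, the far column, the host tables (HostTop / HostStep of part 2) and the terminal certificate.
No `sorry`, no new axioms, zero edits to landed declarations.
-/

namespace Summit.AtomisticToContinuum.Crystallization.Theorems.FrustratedLawDichotomyStrainedPatchBondCalculus

open scoped BigOperators Classical RealInnerProductSpace
open Set
open Summit.AtomisticToContinuum.Crystallization.Theorems.FrustratedLawDichotomyMotifLemmas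
open Summit.AtomisticToContinuum.Crystallization.Theorems.FrustratedLawDichotomyAveragingCut
open Summit.AtomisticToContinuum.Crystallization.Theorems.FrustratedLawDichotomyStrainedPatchHomSplit
open Summit.AtomisticToContinuum.Crystallization.Theorems.FrustratedLawDichotomyStrainedPatchCoreTube
open Summit.AtomisticToContinuum.Crystallization.Theorems.FrustratedLawDichotomyStrainedPatchEnvelopeLaw
open Summit.AtomisticToContinuum.Crystallization.Theorems.FrustratedLawDichotomyStrainedPatchEnvelopeTaylor
open Summit.AtomisticToContinuum.Crystallization.Theorems.FrustratedLawDichotomyStrainedPatchChartFamilies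
open Summit.AtomisticToContinuum.Crystallization.Theorems.FrustratedLawDichotomyStrainedPatchChartFamiliesPinned
open Summit.AtomisticToContinuum.Crystallization.Theorems.FrustratedLawDichotomyStrainedPatchQuantSlaving
open Summit.AtomisticToContinuum.Crystallization.Theorems.FrustratedLawDichotomyStrainedPatchHostCells
open Summit.AtomisticToContinuum.Crystallization.Theorems.FrustratedLawDichotomyStrainedPatchForceCap
open Summit.AtomisticToContinuum.Crystallization.Theorems.FrustratedLawDichotomyStrainedPatchSVCharge
open Summit.AtomisticToContinuum.Crystallization.Theorems.FrustratedLawDichotomyStrainedPatchChargePrice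
open Summit.AtomisticToContinuum.Crystallization.Theorems.FrustratedLawDichotomyStrainedPatchTaylorTop
open Summit.AtomisticToContinuum.Crystallization.Theorems.FrustratedLawDichotomyStrainedPatchTaylorCharge
open Summit.AtomisticToContinuum.Crystallization.Theorems.FrustratedLawDichotomyStrainedPatchHostStep

/-! ## §1. Scalar closed forms -/

/-- `ψ(r) = 14r⁻¹⁶ − 8r⁻¹⁰` — the radial coefficient of `pairHess` (`= (V″ − V′/r)/r²`). -/
noncomputable def bondPsi (r : ℝ) : ℝ := 14 * r⁻¹ ^ 16 - 8 * r⁻¹ ^ 10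
/-- `χ(r) = ψ′(r)/r = −224r⁻¹⁸ + 80r⁻¹²` — the radial coefficient of `bondD3`. -/
noncomputable def bondChi (r : ℝ) : ℝ := -224 * r⁻¹ ^ 18 + 80 * r⁻¹ ^ 12
/-- `ψ′(r) = −224r⁻¹⁷ + 80r⁻¹¹`. -/
noncomputable def bondPsiD (r : ℝ) : ℝ := -224 * r⁻¹ ^ 17 + 80 * r⁻¹ ^ 11
/-- `χ′(r) = 4032r⁻¹⁹ − 960r⁻¹³`. -/
noncomputable def bondChiD (r : ℝ) : ℝ := 4032 * r⁻¹ ^ 19 - 960 * r⁻¹ ^ 13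
/-- `γ(r) = |χ′|r³ + 3|χ|r² + 3|ψ′|r + 3|ψ|` — the SCALAR γ-TABLE integrand: `‖d/dt bondD3(q + tΔ)[u,v]‖ ≤ γ(‖q + tΔ‖)‖Δ‖‖u‖‖v‖` (§4). -/
noncomputable def bondGamma (r : ℝ) : ℝ := |bondChiD r| * r ^ 3 + 3 * |bondChi r| * r ^ 2 + 3 * |bondPsiD r| * r + 3 * |bondPsi r|

/-- `V′(r)/r = −r⁻¹⁴ + r⁻⁸` (all `r`, junk-compatible at 0). [formal bookkeeping] -/
theorem ljD1_div_eq (r : ℝ) : ljD1 r / r = -(r⁻¹ ^ 14) + r⁻¹ ^ 8 := by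
  simp only [ljD1, div_eq_mul_inv]; ring

/-- `(V″(r) − V′(r)/r)/r² = ψ(r)` (all `r`). [formal bookkeeping] -/
theorem pairHess_coeff_eq (r : ℝ) : (ljD2 r - ljD1 r / r) / r ^ 2 = bondPsi r := by
  simp only [ljD2, ljD1, bondPsi, div_eq_mul_inv, ← inv_pow]
  ring

/-- `d/dr (−r⁻¹⁴ + r⁻⁸) = 14r⁻¹⁵ − 8r⁻⁹` (`r ≠ 0`). [elementary] -/
theorem hasDerivAt_phi {r : ℝ} (hr : r ≠ 0) : HasDerivAt (fun s : ℝ => -(s⁻¹ ^ 14) + s⁻¹ ^ 8) (14 * r⁻¹ ^ 15 - 8 * r⁻¹ ^ 9) r := by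
  have h1 : HasDerivAt (fun s : ℝ => s⁻¹) (-(r ^ 2)⁻¹) r := hasDerivAt_inv hr
  refine ((h1.fun_pow 14).fun_neg.fun_add (h1.fun_pow 8)).congr_deriv ?_
  rw [← inv_pow]
  push_cast
  ring

/-- `ψ(r)·r = 14r⁻¹⁵ − 8r⁻⁹` (`r ≠ 0`). [formal bookkeeping] -/
theorem bondPsi_mul {r : ℝ} (hr : r ≠ 0) : bondPsi r * r = 14 * r⁻¹ ^ 15 - 8 * r⁻¹ ^ 9 := by
  have hu : r⁻¹ * r = 1 := inv_mul_cancel₀ hr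
  unfold bondPsi
  linear_combination (14 * r⁻¹ ^ 15 - 8 * r⁻¹ ^ 9) * hu

/-- `ψ′(r) = −224r⁻¹⁷ + 80r⁻¹¹` (`r ≠ 0`). [elementary] -/
theorem hasDerivAt_bondPsi {r : ℝ} (hr : r ≠ 0) : HasDerivAt bondPsi (bondPsiD r) r := by
  have h1 : HasDerivAt (fun s : ℝ => s⁻¹) (-(r ^ 2)⁻¹) r := hasDerivAt_inv hr
  have h := ((h1.fun_pow 16).const_mul (14 : ℝ)).fun_sub ((h1.fun_pow 10).const_mul (8 : ℝ))
  refine HasDerivAt.congr_deriv (f := bondPsi) h ?_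
  rw [bondPsiD, ← inv_pow]
  push_cast
  ring

/-- `χ′` (`r ≠ 0`). [elementary] -/
theorem hasDerivAt_bondChi {r : ℝ} (hr : r ≠ 0) : HasDerivAt bondChi (bondChiD r) r := by
  have h1 : HasDerivAt (fun s : ℝ => s⁻¹) (-(r ^ 2)⁻¹) r := hasDerivAt_inv hr
  have h := ((h1.fun_pow 18).const_mul (-224 : ℝ)).fun_add ((h1.fun_pow 12).const_mul (80 : ℝ))
  refine HasDerivAt.congr_deriv (f := bondChi) h ?_
  rw [bondChiD, ← inv_pow]
  push_cast
  ring

/-- `χ(r)·r = ψ′(r)` (`r ≠ 0`). [formal bookkeeping] -/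
theorem bondChi_mul {r : ℝ} (hr : r ≠ 0) : bondChi r * r = bondPsiD r := by
  have hu : r⁻¹ * r = 1 := inv_mul_cancel₀ hr
  unfold bondChi bondPsiD
  linear_combination (-224 * r⁻¹ ^ 17 + 80 * r⁻¹ ^ 11) * hu
/-! ## §2. Fréchet derivatives off the origin -/

/-- `D‖·‖(x) = ⟨x,·⟩/‖x‖` (`x ≠ 0`). [folklore] -/
theorem hasFDerivAt_norm_E3 {x : E3} (hx : x ≠ 0) : HasFDerivAt (fun y : E3 => ‖y‖) (‖x‖⁻¹ • innerSL ℝ x) x := by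
  have hpos : 0 < ‖x‖ := norm_pos_iff.2 hx
  have h1 : HasFDerivAt (fun y : E3 => ‖y‖ ^ 2) (2 • innerSL ℝ x) x := (hasStrictFDerivAt_norm_sq x).hasFDerivAt
  have h2 := h1.sqrt (pow_ne_zero 2 hpos.ne')
  have heq : (fun y : E3 => Real.sqrt (‖y‖ ^ 2)) = fun y => ‖y‖ := funext fun y => Real.sqrt_sq (norm_nonneg y)
  rw [heq] at h2
  refine h2.congr_fderiv ?_
  ext u
  simp only [FunLike.coe_smul, Pi.smul_apply, smul_eq_mul, nsmul_eq_mul, Nat.cast_ofNat, Pi.mul_apply, Pi.ofNat_apply,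
    innerSL_apply_apply, Real.sqrt_sq hpos.le]
  field_simp

/-- `innerSL` read through the `→L[ℝ]` coercion used below. [formal bookkeeping] -/
theorem innerSL_real_apply (u v : E3) : (innerSL ℝ : E3 →L[ℝ] E3 →L[ℝ] ℝ) u v = ⟪u, v⟫ := innerSL_apply_apply (𝕜 := ℝ) u v

/-- RADIAL CHAIN RULE: `D(g ∘ ‖·‖)(x) = k·⟨x,·⟩` when `g′(‖x‖) = k·‖x‖` (`x ≠ 0`). [elementary] -/
theorem hasFDerivAt_radial {g : ℝ → ℝ} {k : ℝ} {x : E3} (hx : x ≠ 0) (hg : HasDerivAt g (k * ‖x‖) ‖x‖) :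
    HasFDerivAt (fun y : E3 => g ‖y‖) (k • innerSL ℝ x) x := by
  have hpos : 0 < ‖x‖ := norm_pos_iff.2 hx
  refine (hg.comp_hasFDerivAt x (hasFDerivAt_norm_E3 hx)).congr_fderiv ?_
  rw [smul_smul, mul_inv_cancel_right₀ hpos.ne']

/-- `bondForce y = φ(‖y‖)·y` with `φ` in closed form (all `y`). [formal bookkeeping] -/
theorem bondForce_eq (y : E3) : bondForce y = (-(‖y‖⁻¹ ^ 14) + ‖y‖⁻¹ ^ 8) • y := by
  rw [bondForce, ljD1_div_eq]

/-- The quadratic map `Sq(y) = ⟨y,·⟩y` and its derivative `sqD x u = ⟨u,·⟩x + ⟨x,·⟩u`. -/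
noncomputable def sqD (x : E3) : E3 →L[ℝ] E3 →L[ℝ] E3 :=
  ((isBoundedBilinearMap_smulRight : IsBoundedBilinearMap ℝ fun p : (E3 →L[ℝ] ℝ) × E3 => p.1.smulRight p.2).deriv (innerSL ℝ x, x)).comp
    ((innerSL ℝ : E3 →L[ℝ] E3 →L[ℝ] ℝ).prod (ContinuousLinearMap.id ℝ E3))

/-- `sqD_apply_apply` (docstring added by the landing lane; see the module docstring). [formal bookkeeping] -/
theorem sqD_apply_apply (x u v : E3) : sqD x u v = ⟪u, v⟫ • x + ⟪x, v⟫ • u := by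
  simp [sqD, IsBoundedBilinearMap.deriv_apply, add_comm]
  exact congrArg (fun t : ℝ => t • x) (innerSL_real_apply u v)

/-- `hasFDerivAt_sq` (docstring added by the landing lane; see the module docstring). [formal bookkeeping] -/
theorem hasFDerivAt_sq (x : E3) : HasFDerivAt (fun y : E3 => (innerSL ℝ y).smulRight y) (sqD x) x := by
  have hB : IsBoundedBilinearMap ℝ fun p : (E3 →L[ℝ] ℝ) × E3 => p.1.smulRight p.2 := isBoundedBilinearMap_smulRight
  have hpair : HasFDerivAt (fun y : E3 => (innerSL ℝ y, y)) ((innerSL ℝ : E3 →L[ℝ] E3 →L[ℝ] ℝ).prod (ContinuousLinearMap.id ℝ E3)) x :=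
    ((innerSL ℝ : E3 →L[ℝ] E3 →L[ℝ] ℝ).hasFDerivAt).prodMk (hasFDerivAt_id x)
  have h : HasFDerivAt ((fun p : (E3 →L[ℝ] ℝ) × E3 => p.1.smulRight p.2) ∘ fun y : E3 => (innerSL ℝ y, y)) (sqD x) x :=
    HasFDerivAt.comp x (hB.hasFDerivAt (innerSL ℝ x, x)) hpair
  exact h

/-- `pairHess` in closed form (all `y`). [formal bookkeeping] -/
theorem pairHess_eq (y : E3) : pairHess y = bondPsi ‖y‖ • (innerSL ℝ y).smulRight y + (-(‖y‖⁻¹ ^ 14) + ‖y‖⁻¹ ^ 8) • ContinuousLinearMap.id ℝ E3 := by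
  rw [pairHess, pairHess_coeff_eq, ljD1_div_eq]

/-- ★ **`D bondForce (x) = pairHess x`** (`x ≠ 0`). [elementary calculus of the LJ bond force] -/
theorem hasFDerivAt_bondForce {x : E3} (hx : x ≠ 0) : HasFDerivAt bondForce (pairHess x) x := by
  have hpos : 0 < ‖x‖ := norm_pos_iff.2 hx
  have hφ : HasFDerivAt (fun y : E3 => -(‖y‖⁻¹ ^ 14) + ‖y‖⁻¹ ^ 8) (bondPsi ‖x‖ • innerSL ℝ x) x :=
    hasFDerivAt_radial (g := fun s : ℝ => -(s⁻¹ ^ 14) + s⁻¹ ^ 8) hx (by rw [bondPsi_mul hpos.ne']; exact hasDerivAt_phi hpos.ne')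
  have h : HasFDerivAt (fun y : E3 => (-(‖y‖⁻¹ ^ 14) + ‖y‖⁻¹ ^ 8) • y)
      ((-(‖x‖⁻¹ ^ 14) + ‖x‖⁻¹ ^ 8) • ContinuousLinearMap.id ℝ E3 + (bondPsi ‖x‖ • innerSL ℝ x).smulRight x) x :=
    hφ.smul (hasFDerivAt_id x)
  have heq : (fun y : E3 => (-(‖y‖⁻¹ ^ 14) + ‖y‖⁻¹ ^ 8) • y) = bondForce := funext fun y => (bondForce_eq y).symm
  rw [heq] at h
  refine h.congr_fderiv ?_
  rw [pairHess_eq]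
  ext1 u
  simp only [add_apply, FunLike.coe_smul, Pi.smul_apply, ContinuousLinearMap.smulRight_apply, ContinuousLinearMap.id_apply,
    innerSL_apply_apply, smul_eq_mul]
  module

/-- ★ **THE THIRD DERIVATIVE OF THE BOND POTENTIAL (second of the bond force) in closed form** — the census B-table:
`bondD3 x = ψ(‖x‖)·sqD x + (χ(‖x‖)⟨x,·⟩) ⊗ ⟨x,·⟩x + (ψ(‖x‖)⟨x,·⟩) ⊗ 1`. -/
noncomputable def bondD3 (x : E3) : E3 →L[ℝ] E3 →L[ℝ] E3 :=
  bondPsi ‖x‖ • sqD x + (bondChi ‖x‖ • innerSL ℝ x).smulRight ((innerSL ℝ x).smulRight x) +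
    (bondPsi ‖x‖ • innerSL ℝ x).smulRight (ContinuousLinearMap.id ℝ E3)

/-- `bondD3 x u v = χ⟨x,u⟩⟨x,v⟩·x + ψ(⟨u,v⟩·x + ⟨x,v⟩·u + ⟨x,u⟩·v)` (symmetric in `u, v`). [formal bookkeeping] -/
theorem bondD3_apply_apply (x u v : E3) :
    bondD3 x u v = (bondChi ‖x‖ * ⟪x, u⟫ * ⟪x, v⟫) • x + bondPsi ‖x‖ • (⟪u, v⟫ • x + ⟪x, v⟫ • u + ⟪x, u⟫ • v) := by
  simp only [bondD3, add_apply, FunLike.coe_smul, Pi.smul_apply, ContinuousLinearMap.smulRight_apply, ContinuousLinearMap.id_apply,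
    innerSL_apply_apply, sqD_apply_apply, smul_eq_mul]
  module

/-- ★ **`D pairHess (x) = bondD3 x`** (`x ≠ 0`). [elementary calculus] -/
theorem hasFDerivAt_pairHess {x : E3} (hx : x ≠ 0) : HasFDerivAt pairHess (bondD3 x) x := by
  have hpos : 0 < ‖x‖ := norm_pos_iff.2 hx
  have hψ : HasFDerivAt (fun y : E3 => bondPsi ‖y‖) (bondChi ‖x‖ • innerSL ℝ x) x :=
    hasFDerivAt_radial hx (by rw [bondChi_mul hpos.ne']; exact hasDerivAt_bondPsi hpos.ne')
  have hφ : HasFDerivAt (fun y : E3 => -(‖y‖⁻¹ ^ 14) + ‖y‖⁻¹ ^ 8) (bondPsi ‖x‖ • innerSL ℝ x) x :=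
    hasFDerivAt_radial (g := fun s : ℝ => -(s⁻¹ ^ 14) + s⁻¹ ^ 8) hx (by rw [bondPsi_mul hpos.ne']; exact hasDerivAt_phi hpos.ne')
  have h1 : HasFDerivAt (fun y : E3 => bondPsi ‖y‖ • (innerSL ℝ y).smulRight y)
      (bondPsi ‖x‖ • sqD x + (bondChi ‖x‖ • innerSL ℝ x).smulRight ((innerSL ℝ x).smulRight x)) x := hψ.smul (hasFDerivAt_sq x)
  have h2 : HasFDerivAt (fun y : E3 => (-(‖y‖⁻¹ ^ 14) + ‖y‖⁻¹ ^ 8) • ContinuousLinearMap.id ℝ E3)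
      ((bondPsi ‖x‖ • innerSL ℝ x).smulRight (ContinuousLinearMap.id ℝ E3)) x := hφ.smul_const (ContinuousLinearMap.id ℝ E3)
  have h : HasFDerivAt (fun y : E3 => bondPsi ‖y‖ • (innerSL ℝ y).smulRight y + (-(‖y‖⁻¹ ^ 14) + ‖y‖⁻¹ ^ 8) • ContinuousLinearMap.id ℝ E3)
      (bondD3 x) x := h1.add h2
  have heq : (fun y : E3 => bondPsi ‖y‖ • (innerSL ℝ y).smulRight y + (-(‖y‖⁻¹ ^ 14) + ‖y‖⁻¹ ^ 8) • ContinuousLinearMap.id ℝ E3) = pairHess :=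
    funext fun y => (pairHess_eq y).symm
  rw [heq] at h
  exact h
/-! ## §3. (C2L) from the Lipschitz table of `bondD3`; the M-leaf from the table -/

/-- Points of a segment over a bond of the shell stay off the origin: `‖q + tΔ‖ ≥ s₀ − m > 0`. [elementary] -/
theorem norm_seg_pos {s₀ m : ℝ} (hms : m < s₀) {q Δ : E3} (hq : s₀ ≤ ‖q‖) (hΔ : ‖Δ‖ ≤ m) {t : ℝ} (ht : t ∈ Icc (0 : ℝ) 1) : q + t • Δ ≠ 0 := by
  intro h0
  have h1 : ‖q‖ = ‖t • Δ‖ := by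
    have : q = -(t • Δ) := eq_neg_of_add_eq_zero_left h0
    rw [this, norm_neg]
  have h2 : ‖t • Δ‖ ≤ m := by
    rw [norm_smul, Real.norm_eq_abs, abs_of_nonneg ht.1]
    calc t * ‖Δ‖ ≤ 1 * ‖Δ‖ := by gcongr; exact ht.2
      _ ≤ m := by rw [one_mul]; exact hΔ
  linarith

/-- ★★ **(C2L) FROM THE LIPSCHITZ TABLE**: if `m < s₀` and `‖bondD3 (q + tΔ) − bondD3 q‖ ≤ L(‖q‖)·t‖Δ‖` on the shells, then
`BondHessLip bondD3 L s₀ r m` — the two derivative conjuncts are THEOREMS (§2). [formal bookkeeping over §2] -/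
theorem bondHessLip_of_table {L : ℝ → ℝ} {s₀ r m : ℝ} (hms : m < s₀)
    (hL : ∀ q Δ : E3, s₀ ≤ ‖q‖ → ‖q‖ < r → ‖Δ‖ ≤ m → ∀ t ∈ Icc (0 : ℝ) 1, ‖bondD3 (q + t • Δ) - bondD3 q‖ ≤ L ‖q‖ * (t * ‖Δ‖)) :
    BondHessLip bondD3 L s₀ r m := fun q Δ hq hr hΔ t ht =>
  ⟨hasFDerivAt_bondForce (norm_seg_pos hms hq hΔ ht), hasFDerivAt_pairHess (norm_seg_pos hms hq hΔ ht), hL q Δ hq hr hΔ t ht⟩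

/-- ★★★ **THE M-LEAF FROM THE TABLE**: `PricedCharge 𝓘 τ (quadPrice bondD3 (cubicTail L) r) X ⟸` the Lipschitz table of `bondD3` at `m = 2τ < s₀`,
host separation `s₀`, and the far column. [formal bookkeeping: `bondHessLip_of_table` + part 1] -/
theorem pricedCharge_quadPrice_of_table {𝓘 : ChartFam} {τ s₀ r : ℝ} {L : ℝ → ℝ} {X : SlackTab} (hτs : 2 * τ < s₀)
    (hL : ∀ q Δ : E3, s₀ ≤ ‖q‖ → ‖q‖ < r → ‖Δ‖ ≤ 2 * τ → ∀ t ∈ Icc (0 : ℝ) 1, ‖bondD3 (q + t • Δ) - bondD3 q‖ ≤ L ‖q‖ * (t * ‖Δ‖))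
    (hsep : HostSep 𝓘 s₀) (hX : FarColumn 𝓘 τ r X) : PricedCharge 𝓘 τ (quadPrice bondD3 (cubicTail L) r) X :=
  pricedCharge_quadPrice_of_bondHessLip (bondHessLip_of_table hτs hL) hsep hX

/-! ## §4. (C2L) from the SCALAR γ-TABLE: the Lipschitz modulus of `bondD3` along bond segments

Along `y(σ) = q + σΔ` the map `σ ↦ bondD3 (y σ) u v` is differentiable with `‖d/dσ‖ ≤ γ(‖y σ‖)·‖Δ‖‖u‖‖v‖` (`segDeriv_norm_le`, `hasDerivAt_bondD3_seg`);
the mean value inequality and `opNorm_le_bound` (twice) turn a bound `γ ≤ L(‖q‖)` on the radius band `|s′ − ‖q‖| ≤ m` into the Lipschitz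
row of (C2L) (`norm_bondD3_seg_sub_le`), whence `bondHessLip_of_gammaTable` and the M-leaf `pricedCharge_quadPrice_of_gammaTable`. -/

/-- The segment and its derivative. [elementary] -/
theorem hasDerivAt_seg (q Δ : E3) (t : ℝ) : HasDerivAt (fun σ : ℝ => q + σ • Δ) Δ t := by
  simpa using ((hasDerivAt_id t).smul_const Δ).const_add q

/-- `d/dσ ⟨q + σΔ, w⟩ = ⟨Δ, w⟩`. [elementary] -/
theorem hasDerivAt_inner_seg (q Δ w : E3) (t : ℝ) : HasDerivAt (fun σ : ℝ => ⟪q + σ • Δ, w⟫) ⟪Δ, w⟫ t := by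
  have h : (fun σ : ℝ => ⟪q + σ • Δ, w⟫) = fun σ => ⟪q, w⟫ + σ * ⟪Δ, w⟫ := funext fun σ => by rw [inner_add_left, real_inner_smul_left]
  rw [h]
  simpa using ((hasDerivAt_id t).mul_const ⟪Δ, w⟫).const_add ⟪q, w⟫

/-- `d/dσ ‖q + σΔ‖ = ⟨q + σΔ, Δ⟩/‖q + σΔ‖` off the origin. [elementary] -/
theorem hasDerivAt_norm_seg {q Δ : E3} {t : ℝ} (h0 : q + t • Δ ≠ 0) :
    HasDerivAt (fun σ : ℝ => ‖q + σ • Δ‖) (‖q + t • Δ‖⁻¹ * ⟪q + t • Δ, Δ⟫) t := by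
  refine ((hasFDerivAt_norm_E3 h0).comp_hasDerivAt t (hasDerivAt_seg q Δ t)).congr_deriv ?_
  simp only [FunLike.coe_smul, Pi.smul_apply, innerSL_apply_apply, smul_eq_mul]

/-- `|⟨y, Δ⟩/‖y‖| ≤ ‖Δ‖`. [elementary] -/
theorem abs_inv_norm_mul_inner_le (y Δ : E3) : |‖y‖⁻¹ * ⟪y, Δ⟫| ≤ ‖Δ‖ := by
  rcases eq_or_ne y 0 with h | h
  · simp [h]
  have hpos : 0 < ‖y‖ := norm_pos_iff.2 h
  rw [abs_mul, abs_inv, abs_norm]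
  calc ‖y‖⁻¹ * |⟪y, Δ⟫| ≤ ‖y‖⁻¹ * (‖y‖ * ‖Δ‖) := by gcongr; exact abs_real_inner_le_norm y Δ
    _ = ‖Δ‖ := by field_simp

/-- ★ THE ALGEBRAIC HEART OF THE γ-TABLE: the norm of the segment derivative of `bondD3 (·) u v` (written out by the product rule) is at most
`(|χ′|ρ³ + 3|χ|ρ² + 3|ψ′|ρ + 3|ψ|)·‖Δ‖‖u‖‖v‖`, `ρ = ‖y‖`. [elementary: Cauchy–Schwarz termwise] -/
theorem segDeriv_norm_le (y Δ u v : E3) (X P χD ψD ρ' : ℝ) (hρ' : |ρ'| ≤ ‖Δ‖) :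
    ‖(X * ⟪y, u⟫ * ⟪y, v⟫) • Δ + ((χD * ρ' * ⟪y, u⟫ + X * ⟪Δ, u⟫) * ⟪y, v⟫ + X * ⟪y, u⟫ * ⟪Δ, v⟫) • y +
        (P • (⟪u, v⟫ • Δ + ⟪Δ, v⟫ • u + ⟪Δ, u⟫ • v) + (ψD * ρ') • (⟪u, v⟫ • y + ⟪y, v⟫ • u + ⟪y, u⟫ • v))‖ ≤
      (|χD| * ‖y‖ ^ 3 + 3 * |X| * ‖y‖ ^ 2 + 3 * |ψD| * ‖y‖ + 3 * |P|) * (‖Δ‖ * ‖u‖ * ‖v‖) := by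
  have ha : |⟪y, u⟫| ≤ ‖y‖ * ‖u‖ := abs_real_inner_le_norm y u
  have hb : |⟪y, v⟫| ≤ ‖y‖ * ‖v‖ := abs_real_inner_le_norm y v
  have ha' : |⟪Δ, u⟫| ≤ ‖Δ‖ * ‖u‖ := abs_real_inner_le_norm Δ u
  have hb' : |⟪Δ, v⟫| ≤ ‖Δ‖ * ‖v‖ := abs_real_inner_le_norm Δ v
  have huv : |⟪u, v⟫| ≤ ‖u‖ * ‖v‖ := abs_real_inner_le_norm u v
  have hA : ‖(X * ⟪y, u⟫ * ⟪y, v⟫) • Δ‖ ≤ |X| * (‖y‖ * ‖u‖) * (‖y‖ * ‖v‖) * ‖Δ‖ := by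
    rw [norm_smul, Real.norm_eq_abs, abs_mul, abs_mul]
    gcongr
  have hB : ‖((χD * ρ' * ⟪y, u⟫ + X * ⟪Δ, u⟫) * ⟪y, v⟫ + X * ⟪y, u⟫ * ⟪Δ, v⟫) • y‖ ≤
      ((|χD| * ‖Δ‖ * (‖y‖ * ‖u‖) + |X| * (‖Δ‖ * ‖u‖)) * (‖y‖ * ‖v‖) + |X| * (‖y‖ * ‖u‖) * (‖Δ‖ * ‖v‖)) * ‖y‖ := by
    rw [norm_smul, Real.norm_eq_abs]
    gcongr
    calc |(χD * ρ' * ⟪y, u⟫ + X * ⟪Δ, u⟫) * ⟪y, v⟫ + X * ⟪y, u⟫ * ⟪Δ, v⟫|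
        ≤ |(χD * ρ' * ⟪y, u⟫ + X * ⟪Δ, u⟫) * ⟪y, v⟫| + |X * ⟪y, u⟫ * ⟪Δ, v⟫| := abs_add_le _ _
      _ ≤ (|χD * ρ' * ⟪y, u⟫| + |X * ⟪Δ, u⟫|) * |⟪y, v⟫| + |X| * |⟪y, u⟫| * |⟪Δ, v⟫| := by
          rw [abs_mul, abs_mul, abs_mul X]
          gcongr
          exact abs_add_le _ _
      _ = (|χD| * |ρ'| * |⟪y, u⟫| + |X| * |⟪Δ, u⟫|) * |⟪y, v⟫| + |X| * |⟪y, u⟫| * |⟪Δ, v⟫| := by rw [abs_mul, abs_mul, abs_mul]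
      _ ≤ (|χD| * ‖Δ‖ * (‖y‖ * ‖u‖) + |X| * (‖Δ‖ * ‖u‖)) * (‖y‖ * ‖v‖) + |X| * (‖y‖ * ‖u‖) * (‖Δ‖ * ‖v‖) := by gcongr
  have hC : ‖P • (⟪u, v⟫ • Δ + ⟪Δ, v⟫ • u + ⟪Δ, u⟫ • v)‖ ≤ |P| * (‖u‖ * ‖v‖ * ‖Δ‖ + ‖Δ‖ * ‖v‖ * ‖u‖ + ‖Δ‖ * ‖u‖ * ‖v‖) := by
    rw [norm_smul, Real.norm_eq_abs]
    gcongr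
    calc ‖⟪u, v⟫ • Δ + ⟪Δ, v⟫ • u + ⟪Δ, u⟫ • v‖ ≤ ‖⟪u, v⟫ • Δ‖ + ‖⟪Δ, v⟫ • u‖ + ‖⟪Δ, u⟫ • v‖ := norm_add₃_le
      _ = |⟪u, v⟫| * ‖Δ‖ + |⟪Δ, v⟫| * ‖u‖ + |⟪Δ, u⟫| * ‖v‖ := by simp only [norm_smul, Real.norm_eq_abs]
      _ ≤ ‖u‖ * ‖v‖ * ‖Δ‖ + ‖Δ‖ * ‖v‖ * ‖u‖ + ‖Δ‖ * ‖u‖ * ‖v‖ := by gcongr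
  have hD : ‖(ψD * ρ') • (⟪u, v⟫ • y + ⟪y, v⟫ • u + ⟪y, u⟫ • v)‖ ≤ |ψD| * ‖Δ‖ * (‖u‖ * ‖v‖ * ‖y‖ + ‖y‖ * ‖v‖ * ‖u‖ + ‖y‖ * ‖u‖ * ‖v‖) := by
    rw [norm_smul, Real.norm_eq_abs, abs_mul]
    gcongr
    calc ‖⟪u, v⟫ • y + ⟪y, v⟫ • u + ⟪y, u⟫ • v‖ ≤ ‖⟪u, v⟫ • y‖ + ‖⟪y, v⟫ • u‖ + ‖⟪y, u⟫ • v‖ := norm_add₃_le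
      _ = |⟪u, v⟫| * ‖y‖ + |⟪y, v⟫| * ‖u‖ + |⟪y, u⟫| * ‖v‖ := by simp only [norm_smul, Real.norm_eq_abs]
      _ ≤ ‖u‖ * ‖v‖ * ‖y‖ + ‖y‖ * ‖v‖ * ‖u‖ + ‖y‖ * ‖u‖ * ‖v‖ := by gcongr
  calc _ ≤ ‖(X * ⟪y, u⟫ * ⟪y, v⟫) • Δ + ((χD * ρ' * ⟪y, u⟫ + X * ⟪Δ, u⟫) * ⟪y, v⟫ + X * ⟪y, u⟫ * ⟪Δ, v⟫) • y‖ +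
        ‖P • (⟪u, v⟫ • Δ + ⟪Δ, v⟫ • u + ⟪Δ, u⟫ • v) + (ψD * ρ') • (⟪u, v⟫ • y + ⟪y, v⟫ • u + ⟪y, u⟫ • v)‖ := norm_add_le _ _
    _ ≤ (|X| * (‖y‖ * ‖u‖) * (‖y‖ * ‖v‖) * ‖Δ‖ +
          ((|χD| * ‖Δ‖ * (‖y‖ * ‖u‖) + |X| * (‖Δ‖ * ‖u‖)) * (‖y‖ * ‖v‖) + |X| * (‖y‖ * ‖u‖) * (‖Δ‖ * ‖v‖)) * ‖y‖) +
        (|P| * (‖u‖ * ‖v‖ * ‖Δ‖ + ‖Δ‖ * ‖v‖ * ‖u‖ + ‖Δ‖ * ‖u‖ * ‖v‖) +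
          |ψD| * ‖Δ‖ * (‖u‖ * ‖v‖ * ‖y‖ + ‖y‖ * ‖v‖ * ‖u‖ + ‖y‖ * ‖u‖ * ‖v‖)) :=
        add_le_add ((norm_add_le _ _).trans (add_le_add hA hB)) ((norm_add_le _ _).trans (add_le_add hC hD))
    _ = (|χD| * ‖y‖ ^ 3 + 3 * |X| * ‖y‖ ^ 2 + 3 * |ψD| * ‖y‖ + 3 * |P|) * (‖Δ‖ * ‖u‖ * ‖v‖) := by ring

/-- ★ THE SEGMENT DERIVATIVE OF `bondD3 (·) u v` AND ITS γ-BOUND. [elementary calculus: product and chain rules over §1–§2] -/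
theorem hasDerivAt_bondD3_seg (q Δ u v : E3) {s : ℝ} (h0 : q + s • Δ ≠ 0) :
    ∃ F' : E3, HasDerivAt (fun σ : ℝ => bondD3 (q + σ • Δ) u v) F' s ∧ ‖F'‖ ≤ bondGamma ‖q + s • Δ‖ * (‖Δ‖ * ‖u‖ * ‖v‖) := by
  have hρ0 : 0 < ‖q + s • Δ‖ := norm_pos_iff.2 h0
  have hy : HasDerivAt (fun σ : ℝ => q + σ • Δ) Δ s := hasDerivAt_seg q Δ s
  have hρ : HasDerivAt (fun σ : ℝ => ‖q + σ • Δ‖) (‖q + s • Δ‖⁻¹ * ⟪q + s • Δ, Δ⟫) s := hasDerivAt_norm_seg h0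
  have ha : HasDerivAt (fun σ : ℝ => ⟪q + σ • Δ, u⟫) ⟪Δ, u⟫ s := hasDerivAt_inner_seg q Δ u s
  have hb : HasDerivAt (fun σ : ℝ => ⟪q + σ • Δ, v⟫) ⟪Δ, v⟫ s := hasDerivAt_inner_seg q Δ v s
  have hX : HasDerivAt (fun σ : ℝ => bondChi ‖q + σ • Δ‖) (bondChiD ‖q + s • Δ‖ * (‖q + s • Δ‖⁻¹ * ⟪q + s • Δ, Δ⟫)) s :=
    ((hasDerivAt_bondChi hρ0.ne').comp s hρ :)
  have hP : HasDerivAt (fun σ : ℝ => bondPsi ‖q + σ • Δ‖) (bondPsiD ‖q + s • Δ‖ * (‖q + s • Δ‖⁻¹ * ⟪q + s • Δ, Δ⟫)) s :=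
    ((hasDerivAt_bondPsi hρ0.ne').comp s hρ :)
  have h1 : HasDerivAt (fun σ : ℝ => (bondChi ‖q + σ • Δ‖ * ⟪q + σ • Δ, u⟫ * ⟪q + σ • Δ, v⟫) • (q + σ • Δ))
      ((bondChi ‖q + s • Δ‖ * ⟪q + s • Δ, u⟫ * ⟪q + s • Δ, v⟫) • Δ +
        ((bondChiD ‖q + s • Δ‖ * (‖q + s • Δ‖⁻¹ * ⟪q + s • Δ, Δ⟫) * ⟪q + s • Δ, u⟫ + bondChi ‖q + s • Δ‖ * ⟪Δ, u⟫) * ⟪q + s • Δ, v⟫ +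
            bondChi ‖q + s • Δ‖ * ⟪q + s • Δ, u⟫ * ⟪Δ, v⟫) • (q + s • Δ)) s :=
    ((hX.fun_mul ha).fun_mul hb).fun_smul hy
  have hc : HasDerivAt (fun σ : ℝ => ⟪u, v⟫ • (q + σ • Δ)) (⟪u, v⟫ • Δ) s := hy.const_smul ⟪u, v⟫
  have hS : HasDerivAt (fun σ : ℝ => ⟪u, v⟫ • (q + σ • Δ) + ⟪q + σ • Δ, v⟫ • u + ⟪q + σ • Δ, u⟫ • v) (⟪u, v⟫ • Δ + ⟪Δ, v⟫ • u + ⟪Δ, u⟫ • v) s :=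
    (hc.fun_add (hb.smul_const u)).fun_add (ha.smul_const v)
  have h2 : HasDerivAt (fun σ : ℝ => bondPsi ‖q + σ • Δ‖ • (⟪u, v⟫ • (q + σ • Δ) + ⟪q + σ • Δ, v⟫ • u + ⟪q + σ • Δ, u⟫ • v))
      (bondPsi ‖q + s • Δ‖ • (⟪u, v⟫ • Δ + ⟪Δ, v⟫ • u + ⟪Δ, u⟫ • v) +
        (bondPsiD ‖q + s • Δ‖ * (‖q + s • Δ‖⁻¹ * ⟪q + s • Δ, Δ⟫)) • (⟪u, v⟫ • (q + s • Δ) + ⟪q + s • Δ, v⟫ • u + ⟪q + s • Δ, u⟫ • v)) s :=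
    hP.fun_smul hS
  have hF := h1.fun_add h2
  have heq : (fun σ : ℝ => bondD3 (q + σ • Δ) u v) = fun σ : ℝ =>
      (bondChi ‖q + σ • Δ‖ * ⟪q + σ • Δ, u⟫ * ⟪q + σ • Δ, v⟫) • (q + σ • Δ) +
        bondPsi ‖q + σ • Δ‖ • (⟪u, v⟫ • (q + σ • Δ) + ⟪q + σ • Δ, v⟫ • u + ⟪q + σ • Δ, u⟫ • v) :=
    funext fun σ => bondD3_apply_apply _ _ _
  refine ⟨_, by rw [heq]; exact hF, ?_⟩
  have hb := segDeriv_norm_le (q + s • Δ) Δ u v (bondChi ‖q + s • Δ‖) (bondPsi ‖q + s • Δ‖) (bondChiD ‖q + s • Δ‖) (bondPsiD ‖q + s • Δ‖)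
    (‖q + s • Δ‖⁻¹ * ⟪q + s • Δ, Δ⟫) (abs_inv_norm_mul_inner_le _ _)
  simpa only [bondGamma, mul_assoc] using hb

/-- `γ ≥ 0` on radii. [formal bookkeeping] -/
theorem bondGamma_nonneg {r : ℝ} (hr : 0 ≤ r) : 0 ≤ bondGamma r := by
  unfold bondGamma; positivity

/-- ★★ THE LIPSCHITZ ROW OF (C2L) FROM THE γ-TABLE: if `γ(s′) ≤ L(s)` whenever `s₀ ≤ s < r`, `|s′ − s| ≤ m` (`m < s₀`), then along every bond
segment `‖bondD3 (q + tΔ) − bondD3 q‖ ≤ L(‖q‖)·t‖Δ‖`. [mean value inequality + `opNorm_le_bound` twice over `hasDerivAt_bondD3_seg`] -/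
theorem norm_bondD3_seg_sub_le {L : ℝ → ℝ} {s₀ r m : ℝ} (hms : m < s₀)
    (hL : ∀ s : ℝ, s₀ ≤ s → s < r → ∀ s' : ℝ, |s' - s| ≤ m → bondGamma s' ≤ L s)
    {q Δ : E3} (hq : s₀ ≤ ‖q‖) (hr : ‖q‖ < r) (hΔ : ‖Δ‖ ≤ m) {t : ℝ} (ht : t ∈ Icc (0 : ℝ) 1) :
    ‖bondD3 (q + t • Δ) - bondD3 q‖ ≤ L ‖q‖ * (t * ‖Δ‖) := by
  have hLnn : 0 ≤ L ‖q‖ :=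
    (bondGamma_nonneg (norm_nonneg q)).trans (hL ‖q‖ hq hr ‖q‖ (by rw [sub_self, abs_zero]; exact (norm_nonneg Δ).trans hΔ))
  have hne : ∀ σ ∈ Icc (0 : ℝ) 1, q + σ • Δ ≠ 0 := fun σ hσ => norm_seg_pos hms hq hΔ hσ
  have hband : ∀ σ ∈ Icc (0 : ℝ) 1, bondGamma ‖q + σ • Δ‖ ≤ L ‖q‖ := fun σ hσ =>
    hL ‖q‖ hq hr _ (by
      calc |‖q + σ • Δ‖ - ‖q‖| ≤ ‖q + σ • Δ - q‖ := abs_norm_sub_norm_le _ _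
        _ = σ * ‖Δ‖ := by rw [add_sub_cancel_left, norm_smul, Real.norm_eq_abs, abs_of_nonneg hσ.1]
        _ ≤ 1 * m := by gcongr; exact hσ.2
        _ = m := one_mul m)
  have key : ∀ u v : E3, ‖(bondD3 (q + t • Δ) - bondD3 q) u v‖ ≤ L ‖q‖ * (t * ‖Δ‖) * ‖u‖ * ‖v‖ := by
    intro u v
    choose! F' hF using fun σ (h : q + σ • Δ ≠ 0) => hasDerivAt_bondD3_seg q Δ u v (s := σ) h
    have hmvt := norm_image_sub_le_of_norm_deriv_le_segment' (f := fun σ : ℝ => bondD3 (q + σ • Δ) u v) (f' := F') (a := 0) (b := t)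
      (C := L ‖q‖ * (‖Δ‖ * ‖u‖ * ‖v‖))
      (fun σ hσ => (hF σ (hne σ ⟨hσ.1, hσ.2.trans ht.2⟩)).1.hasDerivWithinAt)
      (fun σ hσ => ((hF σ (hne σ ⟨hσ.1, hσ.2.le.trans ht.2⟩)).2.trans (by
        have := hband σ ⟨hσ.1, hσ.2.le.trans ht.2⟩
        gcongr)))
      t ⟨ht.1, le_rfl⟩
    have h0 : bondD3 (q + (0 : ℝ) • Δ) u v = bondD3 q u v := by rw [zero_smul, add_zero]
    rw [sub_apply, sub_apply]
    calc ‖bondD3 (q + t • Δ) u v - bondD3 q u v‖ = ‖bondD3 (q + t • Δ) u v - bondD3 (q + (0 : ℝ) • Δ) u v‖ := by rw [h0]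
      _ ≤ L ‖q‖ * (‖Δ‖ * ‖u‖ * ‖v‖) * (t - 0) := hmvt
      _ = L ‖q‖ * (t * ‖Δ‖) * ‖u‖ * ‖v‖ := by ring
  refine ContinuousLinearMap.opNorm_le_bound _ (mul_nonneg hLnn (mul_nonneg ht.1 (norm_nonneg Δ))) fun u => ?_
  refine ContinuousLinearMap.opNorm_le_bound _ (mul_nonneg (mul_nonneg hLnn (mul_nonneg ht.1 (norm_nonneg Δ))) (norm_nonneg u)) fun v => ?_
  exact key u v

/-- ★★★ **(C2L) FROM THE SCALAR γ-TABLE**: `m < s₀` and `γ(s′) ≤ L(s)` on the bands `|s′ − s| ≤ m`, `s₀ ≤ s < r` give `BondHessLip bondD3 L s₀ r m`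
— both derivative conjuncts are theorems (§2) and the Lipschitz row is `norm_bondD3_seg_sub_le`. [formal bookkeeping] -/
theorem bondHessLip_of_gammaTable {L : ℝ → ℝ} {s₀ r m : ℝ} (hms : m < s₀)
    (hL : ∀ s : ℝ, s₀ ≤ s → s < r → ∀ s' : ℝ, |s' - s| ≤ m → bondGamma s' ≤ L s) : BondHessLip bondD3 L s₀ r m :=
  bondHessLip_of_table hms fun _ _ hq hr hΔ _ ht => norm_bondD3_seg_sub_le hms hL hq hr hΔ ht

/-- ★★★ **THE M-LEAF FROM THE γ-TABLE**: `PricedCharge 𝓘 τ (quadPrice bondD3 (cubicTail L) r) X ⟸` the scalar table `γ ≤ L` on the `2τ`-bands of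
the bond shells `[s₀, r)` (`2τ < s₀`), host separation `s₀`, and the far column — the ONLY numerical input left on the M-side is a table of the
one-variable closed form `bondGamma`. [formal bookkeeping: `bondHessLip_of_gammaTable` + part 1] -/
theorem pricedCharge_quadPrice_of_gammaTable {𝓘 : ChartFam} {τ s₀ r : ℝ} {L : ℝ → ℝ} {X : SlackTab} (hτs : 2 * τ < s₀)
    (hL : ∀ s : ℝ, s₀ ≤ s → s < r → ∀ s' : ℝ, |s' - s| ≤ 2 * τ → bondGamma s' ≤ L s)
    (hsep : HostSep 𝓘 s₀) (hX : FarColumn 𝓘 τ r X) : PricedCharge 𝓘 τ (quadPrice bondD3 (cubicTail L) r) X :=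
  pricedCharge_quadPrice_of_bondHessLip (bondHessLip_of_gammaTable hτs hL) hsep hX

/-- ★★★ **(CORE-FAR) WITH THE LJ BOND TABLES** — the g73 record in its final form: `CoreOffTubeFloor (63/10) (63/10) (24/5) (1/100) 0` from the cover,
the SCALAR γ-TABLE of `bondGamma` on the `2τ`-bands of the bond shells (`2τ < s₀`), host separation `s₀`, the far column `X`, the census HOST TABLES
(`HostTop` at `k 0·σ₁`, `HostStep k i → k (i+1)·σ₁`) for `B = bondD3`, `T = cubicTail L`, and the terminal `SlackCert` at `k n`.
[formal bookkeeping: `bondHessLip_of_gammaTable` + `coreOff_of_hostTables`] -/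
theorem coreOff_of_gammaTable_hostTables {𝓘 : ChartFam} {τ s₀ r : ℝ} {L : ℝ → ℝ} {X : SlackTab} (k : ℕ → ℝ) (n : ℕ) (hτ : 0 ≤ τ)
    (hcov : FamilyCover 𝓘 (24 / 5) (1 / 100) (1 / 8) τ) (hτs : 2 * τ < s₀)
    (hL : ∀ s : ℝ, s₀ ≤ s → s < r → ∀ s' : ℝ, |s' - s| ≤ 2 * τ → bondGamma s' ≤ L s) (hsep : HostSep 𝓘 s₀) (hX : FarColumn 𝓘 τ r X)
    (h0 : HostTop 𝓘 τ bondD3 (cubicTail L) r (k 0 * sigmaOne))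
    (hs : ∀ i : ℕ, i < n → HostStep 𝓘 τ sigmaOne bondD3 (cubicTail L) r hessBlk0 force0 X (k i) (k (i + 1) * sigmaOne))
    (hcert : SlackCert 𝓘 τ (k n) sigmaOne hessBlk0 force0 X) : CoreOffTubeFloor (63 / 10) (63 / 10) (24 / 5) (1 / 100) 0 :=
  coreOff_of_hostTables k n hτ hcov (bondHessLip_of_gammaTable hτs hL) hsep hX h0 hs hcert

end Summit.AtomisticToContinuum.Crystallization.Theorems.FrustratedLawDichotomyStrainedPatchBondCalculus
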